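import Summits.QuantumFields.YangMills.Theorems.BalabanUVNodesN15KingModelProp37AtRegularFieldPackage
import Summits.QuantumFields.YangMills.Theorems.BalabanUVNodesN15KingModelProp37AtRegularFieldEntrywise
import Summits.QuantumFields.YangMills.Theorems.BalabanUVNodesN15KingModelProp37AtRegularFieldBoxWitness

/-!
# N15 (NE2⁺, row s3 KING-MODEL ∕ RIEMANN-KERNEL RUNG) — PART Ζ-i (PACKAGE v2): KING 1986 PROPOSITION 3.7 AT A REGULAR BACKGROUND `A ≠ 0` — ALL EDITIONS OF
# GENERATION 22 UNDER ONE NAME: block-norm reading (torus, vector clause, boxes `□′`), the ENTRYWISE reading in King's gauge, the `δ`-propagator small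
# factor, and the non-vacuity witnesses

count-neutral helper of the pub-ymgap K3⁸ programme (`--supports stmt-QuantumFields-27366`); nothing here is a claim about Bałaban's
non-abelian `G(U)`, the continuum, ℝ⁴, OS axioms, a mass gap or the Clay problem.  One finite torus `T_ε` at fixed `ε`.

[King1986] = C. King, CMP **102** (1986) 649–677: Prop. 3.7 (3.62)–(3.65) p. 663; p. 665 [PDF 17] (render `king-renders/1986-cmp102-king-u1-higgs-I-p017-x2.png`)
*"We note that Proposition 3.7 also holds for G^η_{(j)}(□′) and G^η_{(j)}(□′, Ã^{(k)}), since Theorem 3.3 gives bounds on these operators also."* and *"The propagator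
δG_k(□′, A^{(k)})(x, y) is bounded by C exp[−δ₀|x − y| − δ₀p(L^kε)], since x, y ∈ □."*; p. 661 (3.43)–(3.46), *"|Ã^{(k)}(x)| ≤ Cp(L^kε)|x − x₀|. (3.45)"* (text layer).
This file supersedes PART Ζ-f's `king_prop37_regularField_package` as the citation handle: item (2) now in the ONE-CUBE-SIZE form (Ζ-d v1.1), plus the
entrywise items (6)–(7) (PART Ζ-h).

## What this file proves (0 `def`; a conjunction of landed theorems, BY NAME)

★★★ `king_prop37_regularField_package'` =
(1) `prop37PrintedAt_king_regularField` (torus, block-norm reading) ∧ (2′) `prop37PrintedAt_king_regularField_vector'` (all three displays, one cube size) ∧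
(3) `prop37PrintedAt_king_regularField_box` (boxes `□′`, regularity on `□′` only) ∧ (4) `king_deltaG_smallFactor_intervalBox` (p. 665) ∧
(5) `prop37_regularField_vector_family_nonempty` (non-vacuity + `Prop37KingOrder` exhibited, all three displays) ∧
(6) `prop37KingOrder_king_zeroField_entry` (King's OWN transport-free entrywise reading at `A = 0`, hypothesis-free) ∧
(7) `prop37PrintedAt_king_regularField_entry` (entrywise at a regular `A ≠ 0` in King's gauge `|A_b| ≤ A_∞`, `d|e|A_∞L^kε ≤ 1`) ∧
(8) `prop37_regularField_box_family_nonempty` (the box edition's binders inhabited, `Prop37KingOrder` on an interval-box member).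

HONEST SCOPE.  A package; nothing new is proved.  Readings: (1)–(5) gauge-invariant block norm; (6)–(7) matrix entries with the explicit gauge hypothesis for
`A ≠ 0` (NOT implied by regularity).  `m², μ₀² > 0`; cubic `Shape` tori (torus items) ∕ general volumes with `K₀ ∣ M` (box items); constants per `(α, K₀)`.
NOT an η-rate (King p. 670: Props 3.8∕3.9 are `A = 0` statements); NE2⁺ for Bałaban's `G(U)` NOT proved; N15 NOT discharged.  Unit `pub-ymgap-dag-n15-e` g22, PART Ζ-i.
-/

noncomputable section

namespace Summit.QuantumFields.YangMills.BalabanUVNodes.N15KingModelRung.RegularField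

open Literature.MathematicalPhysics.QuantumFieldTheory.Balaban1983to89
open Literature.MathematicalPhysics.QuantumFieldTheory.Balaban1983to89.HiggsLattice (ChargeData)
open Literature.MathematicalPhysics.QuantumFieldTheory.Balaban1983to89.B1Eq230FluctCov (Ix)
open Literature.MathematicalPhysics.QuantumFieldTheory.Balaban1983to89.B1Eq211ZeroFieldTorus (Shape)
open Literature.MathematicalPhysics.QuantumFieldTheory.Balaban1983to89.B1TorusCubeCover (half)
open Literature.MathematicalPhysics.QuantumFieldTheory.Balaban1983to89.B1Ineq225RegularBox (cellBox)
open Literature.MathematicalPhysics.QuantumFieldTheory.King1986.SlicePropagator (Prop37PrintedAt Prop37KingOrder)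
open Summit.QuantumFields.YangMills.BalabanUVNodes.N15KingModelRung.Curved (VSite bset bdistΩ sdistI legsK kingThm33DataAlong)

/-- ★★★ **KING 1986 PROPOSITION 3.7 AT A REGULAR BACKGROUND — EVERY EDITION OF THE RUNG's GENERATION 22 UNDER ONE NAME** (see the module docstring for the
eight items). [cite: King1986, Prop 3.7 (3.62)–(3.65) p.663, p.665, (3.43)–(3.46) p.661, Thm 3.3 p.656] [cite: Balaban1983Higgs3, (2.10)–(2.12) p.426]
[cite: Balaban1982Higgs1, Prop. 2.1 p.610, p.611 l.1–2, (2.43) p.612] -/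
theorem king_prop37_regularField_package' (d L : ℕ) (hd : 1 ≤ d) (hL : Odd L ∧ 1 < L) {a msq aV msqV : ℝ} (ha : 0 < a) (hmsq : 0 < msq)
    (haV : 0 < aV) (hmsqV : 0 < msqV) (N : ℕ) (C : ChargeData N) :
    -- (1) torus, block-norm reading (PART Ζ-b)
    (∃ K₀min : ℕ, ∀ {α : ℝ}, 0 < α → α < 1 →
      ∃ t Cst δ₀ : ℕ → ℝ, (∀ K₀, 0 < t K₀ ∧ 0 < Cst K₀ ∧ 0 < δ₀ K₀) ∧
      ∀ K₀ : ℕ, K₀min ≤ K₀ →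
      ∀ (P : HiggsLattice.Params) (S : Shape P), P.d = d → P.L = L → K₀ ∣ P.M → 3 * K₀ ≤ 2 * P.M →
      ∀ {k : ℕ}, 1 ≤ k → k ≤ P.K → P.mesh k ≤ 1 →
      ∀ (A : HiggsLattice.VecField P 0) {δA : ℝ}, 0 ≤ δA →
        (∀ (z : HiggsLattice.Site P 0) (μ ν : Fin P.d), |A ⟨z.shift ν, μ⟩ - A ⟨z, μ⟩| ≤ δA) →
        (P.L : ℝ) ^ k * δA * |C.e| ≤ t K₀ →
        Prop37PrintedAt α (kingSliceKernelsReg S C A msq a k) (Cst K₀) (δ₀ K₀)) ∧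
    -- (2′) all three displays, ONE cube size (PART Ζ-d v1.1)
    (∃ K₀min : ℕ, ∀ {α : ℝ}, 0 < α → α < 1 →
      ∃ t Cst δ₀ : ℕ → ℝ, (∀ K₀, 0 < t K₀ ∧ 0 < Cst K₀ ∧ 0 < δ₀ K₀) ∧
      ∀ K₀ : ℕ, K₀min ≤ K₀ →
      ∀ (P : HiggsLattice.Params) (S : Shape P), P.d = d → P.L = L → K₀ ∣ P.M → 3 * K₀ ≤ 2 * P.M →
      ∀ {k : ℕ}, 1 ≤ k → k ≤ P.K → P.mesh k ≤ 1 →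
      ∀ (A : HiggsLattice.VecField P 0) {δA : ℝ}, 0 ≤ δA →
        (∀ (z : HiggsLattice.Site P 0) (μ ν : Fin P.d), |A ⟨z.shift ν, μ⟩ - A ⟨z, μ⟩| ≤ δA) →
        (P.L : ℝ) ^ k * δA * |C.e| ≤ t K₀ →
        Prop37PrintedAt α (kingSliceKernelsRegV S C A msq a k msqV aV) (Cst K₀) (δ₀ K₀)) ∧
    -- (3) boxes □′, regularity on □′ only (PART Ζ-e)
    (∃ K₀min : ℕ, ∀ {α : ℝ}, 0 < α → α < 1 → ∀ K₀ : ℕ, K₀min ≤ K₀ → ∃ t Cst δ₀ : ℝ, 0 < t ∧ 0 < Cst ∧ 0 < δ₀ ∧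
      ∀ (P : HiggsLattice.Params) (hP1 : 1 < P.L), P.d = d → P.L = L → K₀ ∣ P.M →
      ∀ {k : ℕ}, 1 ≤ k → k ≤ P.K → (∀ μ, 3 * half P k K₀ ≤ P.sitesPerDir 0 μ) → P.mesh k ≤ 1 →
      ∀ (lo hi : Fin P.d → ℕ), (∀ μ, 2 * ((hi μ - lo μ) * half P k K₀) ≤ P.sitesPerDir 0 μ) →
      ∀ (A : HiggsLattice.VecField P 0) {δA : ℝ}, 0 ≤ δA →
        (∀ z ∈ cellBox k K₀ (fun μ => Finset.Ico (lo μ) (hi μ)), ∀ μ ν : Fin P.d, |A ⟨z.shift ν, μ⟩ - A ⟨z, μ⟩| ≤ δA) →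
        (P.L : ℝ) ^ k * δA * |C.e| ≤ t →
        Prop37PrintedAt α (kingSliceKernelsRegBox hP1 C lo hi A msq a k K₀) Cst δ₀) ∧
    -- (4) the δ-propagator small factor (PART Ζ-c)
    (∃ K₀min : ℕ, ∀ K₀ : ℕ, K₀min ≤ K₀ → L ∣ K₀ → ∃ t : ℝ, 0 < t ∧
      ∀ (P : HiggsLattice.Params) (_S : Shape P), P.d = d → P.L = L → K₀ ∣ P.M → 3 * K₀ ≤ 2 * P.M →
      ∀ {k : ℕ}, 1 ≤ k → k < P.K → P.mesh k ≤ 1 →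
      ∀ (lo hi : Fin P.d → ℕ), (∀ μ, 2 * ((hi μ - lo μ) * half P k K₀) ≤ P.sitesPerDir 0 μ) →
      ∀ (A : HiggsLattice.VecField P 0) {δ : ℝ}, 0 ≤ δ →
        (∀ (z : HiggsLattice.Site P 0) (μ ν : Fin P.d), |A ⟨z.shift ν, μ⟩ - A ⟨z, μ⟩| ≤ δ) →
        (P.L : ℝ) ^ k * δ * |C.e| ≤ t →
        ∃ δ₀ Cst : ℝ, 0 < δ₀ ∧
          ∀ (p : ℝ) (f : VSite (bset (cellBox k K₀ (fun μ => Finset.Ico (lo μ) (hi μ)))) → EuclideanSpace ℝ (Fin N))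
            (x : VSite (bset (cellBox k K₀ (fun μ => Finset.Ico (lo μ) (hi μ))))),
            p ≤ bdistΩ (cellBox k K₀ (fun μ => Finset.Ico (lo μ) (hi μ))) x.1 / (P.L : ℝ) ^ k →
            ‖(kingThm33DataAlong C P k (cellBox k K₀ (fun μ => Finset.Ico (lo μ) (hi μ)))
                (bset (cellBox k K₀ (fun μ => Finset.Ico (lo μ) (hi μ)))) (fun y x => legsK y x) A a msq).δG f x‖
                ≤ Cst * Real.exp (-(δ₀ * (sdistI x f / (P.L : ℝ) ^ k))) * ‖f‖ * Real.exp (-(δ₀ * p)) ∧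
            ∀ μ : Fin P.d,
              ‖(kingThm33DataAlong C P k (cellBox k K₀ (fun μ => Finset.Ico (lo μ) (hi μ)))
                  (bset (cellBox k K₀ (fun μ => Finset.Ico (lo μ) (hi μ)))) (fun y x => legsK y x) A a msq).δDG μ f x‖
                ≤ Cst * Real.exp (-(δ₀ * (sdistI x f / (P.L : ℝ) ^ k))) * ‖f‖ * Real.exp (-(δ₀ * p))) ∧
    -- (5) non-vacuity + the print-order schema with all three displays on a member
    (∃ (K₀ : ℕ) (P : HiggsLattice.Params) (S : Shape P), P.d = d ∧ P.L = L ∧ K₀ ∣ P.M ∧ 3 * K₀ ≤ 2 * P.M ∧ 1 ≤ P.K ∧ P.mesh 1 ≤ 1 ∧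
      Prop37KingOrder (kingSliceKernelsRegV S C (0 : HiggsLattice.VecField P 0) msq a 1 msqV aV)) ∧
    -- (6) King's own entrywise reading at A = 0, hypothesis-free (PART Ζ-h)
    (∃ K₀min : ℕ, ∀ K₀ : ℕ, K₀min ≤ K₀ →
      ∀ (P : HiggsLattice.Params) (S : Shape P), P.d = d → P.L = L → K₀ ∣ P.M → 3 * K₀ ≤ 2 * P.M →
      ∀ {k : ℕ}, 1 ≤ k → k ≤ P.K → P.mesh k ≤ 1 →
      ∀ (i i' : Ix N), Prop37KingOrder (kingSliceKernelsRegEnt S C (0 : HiggsLattice.VecField P 0) msq a k i i')) ∧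
    -- (7) entrywise at a regular A in King's gauge (PART Ζ-h)
    (∃ K₀min : ℕ, ∀ {α : ℝ}, 0 < α → α < 1 →
      ∃ t Cst δ₀ : ℕ → ℝ, (∀ K₀, 0 < t K₀ ∧ 0 < Cst K₀ ∧ 0 < δ₀ K₀) ∧
      ∀ K₀ : ℕ, K₀min ≤ K₀ →
      ∀ (P : HiggsLattice.Params) (S : Shape P), P.d = d → P.L = L → K₀ ∣ P.M → 3 * K₀ ≤ 2 * P.M →
      ∀ {k : ℕ}, 1 ≤ k → k ≤ P.K → P.mesh k ≤ 1 →
      ∀ (A : HiggsLattice.VecField P 0) {δA : ℝ}, 0 ≤ δA →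
        (∀ (z : HiggsLattice.Site P 0) (μ ν : Fin P.d), |A ⟨z.shift ν, μ⟩ - A ⟨z, μ⟩| ≤ δA) →
        (P.L : ℝ) ^ k * δA * |C.e| ≤ t K₀ →
      ∀ {Asup : ℝ}, (∀ b, |A b| ≤ Asup) → (P.d : ℝ) * |C.e| * Asup * P.mesh k ≤ 1 →
      ∀ (i i' : Ix N), Prop37PrintedAt α (kingSliceKernelsRegEnt S C A msq a k i i') (Cst K₀) (δ₀ K₀)) ∧
    -- (8) non-vacuity of the box edition + the print-order schema on an interval-box member (PART Ζ-e₃)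
    (∃ (K₀ : ℕ) (P : HiggsLattice.Params) (hP1 : 1 < P.L) (k : ℕ),
      P.d = d ∧ P.L = L ∧ K₀ ∣ P.M ∧ 1 ≤ k ∧ k ≤ P.K ∧ (∀ μ, 3 * half P k K₀ ≤ P.sitesPerDir 0 μ) ∧ P.mesh k ≤ 1 ∧
      (∀ μ, 2 * ((1 - 0) * half P k K₀) ≤ P.sitesPerDir 0 μ) ∧
      (bset (cellBox k K₀ (fun _ : Fin P.d => Finset.Ico 0 1))).Nonempty ∧
      Prop37KingOrder (kingSliceKernelsRegBox hP1 C (fun _ => 0) (fun _ => 1) (0 : HiggsLattice.VecField P 0) msq a k K₀)) :=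
  ⟨prop37PrintedAt_king_regularField d L hL ha hmsq N C,
   prop37PrintedAt_king_regularField_vector' d L hd hL ha hmsq haV hmsqV N C,
   prop37PrintedAt_king_regularField_box d L hd hL.2 ha hmsq N C,
   king_deltaG_smallFactor_intervalBox d L hd hL ha hmsq N C,
   prop37_regularField_vector_family_nonempty d L hd hL ha hmsq haV hmsqV N C,
   prop37KingOrder_king_zeroField_entry d L hL ha hmsq N C,
   prop37PrintedAt_king_regularField_entry d L hL ha hmsq N C,
   prop37_regularField_box_family_nonempty d L hd hL ha hmsq N C⟩

end Summit.QuantumFields.YangMills.BalabanUVNodes.N15KingModelRung.RegularField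

end
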